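import Summits.AtomisticToContinuum.HydrodynamicLimit.Theorems.AntiMazurCoboundariesKineticWindowGronwallActivityInversion
import Summits.AtomisticToContinuum.HydrodynamicLimit.Theorems.TwoClocksClampedEntropyClockTimeZeroReference
import HarnessLib

/-!
# Crux `SpeedCapSurgery.CappedEulerLimit` (stmt-AtomisticToContinuum-17739), line `registered`, stub `stub_timeZero`

THE TIME-ZERO MEMBER OF THE THERMODYNAMIC REFERENCE FAMILY IS THE INITIAL LAW, EXACTLY: `TimeZeroIdentity`.
For `σ < σ₀(a₀, θ₀, u₀)`: the `t = 0` LLN pins `(ρ 0, u 0, θ 0) = (rhoLim (profileOf a₀) σ, u₀, θ₀)`; the landed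
`QuenchedCellClock.stub_timeZeroReference` gives the identity for the activity `ρ_0 · Rf(σ³ρ_0)` (insertion factor
`Rf` of `insertionFactor_package`), and the thermodynamic identity `exp(f_ex(η) + η f_ex'(η)) = Rf(η)` on `(0, η₂)`
(last clause of `insertionFactor_package`) identifies `thermoActivity σ (ρ 0)` with that activity once
`ρ_0 σ³ < η₂`, which holds for small `σ` because `ρ 0 = rhoLim ≤ 2·ratioLimit·M` is bounded uniformly in `σ`.
The `def` is VERBATIM the registered skeleton's (`Cruxes/CappedEulerLimit/Lines/registered.lean`, namespace
`…Theorems.CappedEulerLimit`); worker file of the lead prover-line-stmt-AtomisticToContinuum-17739-0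
(`--supports stmt-AtomisticToContinuum-17739`).
-/

noncomputable section

namespace Summit.AtomisticToContinuum.HydrodynamicLimit.Theorems.CappedEulerLimit

open scoped ENNReal NNReal Topology
open MeasureTheory Filter Set
open Literature.Analysis.FluidPDE
open Literature.MathematicalPhysics.KineticTheory
open Summit.AtomisticToContinuum.HydrodynamicLimit.Theorems.KineticWindowGronwallActivityInversion

/-! ## §1 Statement (verbatim from the registered skeleton) -/

/-- **The time-zero member of the EOS reference family IS the initial law.** For all continuous positive
profiles there is `σ₀ > 0` such that for `0 < σ < σ₀`, every classical hard-sphere Euler solution on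
`[0,T)` with `0 < T` and every flow family: if the empirical fields of the initial local Gibbs laws converge
at `t = 0` to `(ρ, ρu, E)(0)`, then `localGibbsLaw σ (thermoActivity σ (ρ 0)) (u 0) (θ 0) N (Φ N)` EQUALS
`localGibbsLaw σ a₀ u₀ θ₀ N (Φ N)` for every `N` (so the initial relative entropy against the reference is
`0`, with no rate lost). No packing guard is needed at `t = 0`: `ρ 0 = rhoLim a₀` is automatically dilute
for `σ < σ₀(a₀)`. Landed for the activity `ρ_0 · Rf(σ³ρ_0)`:
`Theorems/TwoClocksClampedEntropyClockTimeZeroReference.stub_timeZeroReference`. [cite: Yau1991, §2] -/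
def TimeZeroIdentity : Prop :=
  ∀ (a₀ θ₀ : T3 → ℝ) (u₀ : T3 → V3), Continuous a₀ → Continuous θ₀ → Continuous u₀ →
    (∀ x, 0 < a₀ x) → (∀ x, 0 < θ₀ x) →
    ∃ σ₀ : ℝ, 0 < σ₀ ∧ ∀ σ : ℝ, 0 < σ → σ < σ₀ →
      ∀ (T : ℝ) (ρ θ : ℝ → T3 → ℝ) (u : ℝ → T3 → V3), IsHardSphereEulerSolution σ T ρ u θ → 0 < T →
        ∀ Φ : (N : ℕ) → HardSphereFlow (Torus.geometry (Fin 3)) (hsDiameter σ N) (N + 1),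
          TendstoHydroFieldsAt (fun N => localGibbsLaw σ a₀ u₀ θ₀ N (Φ N)) Φ ρ u θ 0 →
          ∀ N : ℕ, localGibbsLaw σ (thermoActivity σ (ρ 0)) (u 0) (θ 0) N (Φ N) =
            localGibbsLaw σ a₀ u₀ θ₀ N (Φ N)

/-! ## §2 The stub -/

/-- **Stub `stub_timeZero` — THE TIME-ZERO REFERENCE IS THE INITIAL LAW, EXACTLY.** `TimeZeroIdentity`.
[cite: Yau1991, §2] [cite: Ruelle1969, §3.4] -/
theorem stub_timeZero : TimeZeroIdentity := by
  intro a₀ θ₀ u₀ ha hθ hu ha0 hθ0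
  -- the insertion factor with the thermodynamic identity `exp(f_ex(η) + η f_ex'(η)) = Rf(η)` on `(0, η₂)`
  obtain ⟨r, hr, Rf, hsol, hbd, hcont, huniq, η₂, hη₂, _hη₂r, hexp⟩ := insertionFactor_package
  -- the identity for the inverted activity `ρ_0 · Rf(σ³ρ_0)` below `σ₁`
  obtain ⟨σ₁, hσ₁, H₁⟩ :=
    QuenchedCellClock.stub_timeZeroReference hr hsol hbd hcont huniq a₀ θ₀ u₀ ha hθ hu ha0 hθ0
  set Q := profileOf a₀ ha ha0 with hQ
  have hM0 := Q.M_pos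
  -- the statics threshold of the profile
  obtain ⟨σs, hσs, hsmall⟩ := exists_smallDensity Q one_pos
  -- the uniform sup bound `rhoLim Q σ < K`, `K = (2e+1) M`
  set K := (2 * Real.exp 1 + 1) * Q.M with hK
  have hK0 : 0 < K := by positivity
  refine ⟨min (min σ₁ σs) (min (r / (3 * Q.M)) (η₂ / K)),
    lt_min (lt_min hσ₁ hσs) (lt_min (by positivity) (div_pos hη₂ hK0)), ?_⟩
  intro σ hσ hσlt T ρ θ u hE hT Φ htie N
  have hσ₁' : σ < σ₁ := hσlt.trans_le ((min_le_left _ _).trans (min_le_left _ _))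
  have hσs' : σ < σs := hσlt.trans_le ((min_le_left _ _).trans (min_le_right _ _))
  have hσr : σ < r / (3 * Q.M) := hσlt.trans_le ((min_le_right _ _).trans (min_le_left _ _))
  have hση : σ < η₂ / K := hσlt.trans_le ((min_le_right _ _).trans (min_le_right _ _))
  have hQs : SmallDensity Q σ := (hsmall σ hσ hσs').1
  have hσ2 : σ ≤ 1 / 2 := hQs.σ_lt_half.le
  have h31 : σ ^ 3 ≤ σ := pow_le_of_le_one hσ.le (hσ2.trans (by norm_num)) three_ne_zero
  -- the range condition `3 Q.M σ³ < r` of the EOS identity (only its positivity clause is used)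
  have h3r : 3 * Q.M * σ ^ 3 < r := by
    have h3M : 0 < 3 * Q.M := by positivity
    calc 3 * Q.M * σ ^ 3 ≤ 3 * Q.M * σ := mul_le_mul_of_nonneg_left h31 h3M.le
      _ < 3 * Q.M * (r / (3 * Q.M)) := mul_lt_mul_of_pos_left hσr h3M
      _ = r := mul_div_cancel₀ r h3M.ne'
  have hρ₀pos : ∀ x, 0 < rhoLim Q σ x := fun x => (QuenchedCellClock.rhoLim_mul_Rf_eq huniq hQs h3r x).1
  -- data pinning at `t = 0`: `ρ 0 = rhoLim Q σ`
  have h0 : (0 : ℝ) ∈ Set.Ico 0 T := ⟨le_rfl, hT⟩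
  obtain ⟨hρ, -, -⟩ := EntropyClockDock.data_eq_of_ties hσ2 Φ ha hθ hu ha0 hθ0 hQs.continuous_rhoLim
    hρ₀pos (EntropyClockDock.tie_rhoLim_of_smallDensity ha hθ hu ha0 hθ0 hσ2 hQs Φ)
    (hE.smooth_density.isSmooth_slice h0).continuous (hE.smooth_velocity.isSmooth_slice h0).continuous
    (hE.smooth_temperature.isSmooth_slice h0).continuous htie
  -- the thermodynamic activity IS the inverted activity, since `0 < ρ_0 σ³ < K σ³ ≤ K σ < η₂`
  have hact : thermoActivity σ (ρ 0) = fun x => ρ 0 x * Rf (σ ^ 3 * ρ 0 x) := by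
    funext x
    have hpos : 0 < ρ 0 x * σ ^ 3 := mul_pos (hE.density_pos 0 h0 x) (pow_pos hσ 3)
    have hlt : ρ 0 x * σ ^ 3 < η₂ := by
      rw [hρ]
      calc rhoLim Q σ x * σ ^ 3 ≤ K * σ ^ 3 :=
            mul_le_mul_of_nonneg_right (DenseExcursionAtTimeZero.rhoLim_lt hQs x).le (pow_pos hσ 3).le
        _ ≤ K * σ := mul_le_mul_of_nonneg_left h31 hK0.le
        _ < K * (η₂ / K) := mul_lt_mul_of_pos_left hση hK0
        _ = η₂ := mul_div_cancel₀ η₂ hK0.ne'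
    simp only [thermoActivity]
    rw [hexp _ ⟨hpos, hlt⟩, mul_comm (ρ 0 x) (σ ^ 3)]
  rw [hact]
  exact H₁ σ hσ hσ₁' T ρ θ u hE hT Φ htie N

end Summit.AtomisticToContinuum.HydrodynamicLimit.Theorems.CappedEulerLimit

end
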